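import Mathlib
import Summits.CriticalPhenomena.PercolationContinuityZ3.Theorems.PercNearOneGluingNoHeavyLowerTailOrderedDifferencesProducts

/-!
# The bad locus of the Marica–Schönheim pencil is a group; CONJECTURE J ⟺ its case `θ = −1` (quantified forms)

Helper file for crux `stmt-CriticalPhenomena-4575` (`NoHeavyLowerTail`, route `PercNearOneGluingNoHeavy`), new-inequality factory
seat `prim-ineq-gen-3` (gen 31).  Everything here is PROVED; no definitions.  Imports Mathlib and `…OrderedDifferencesProducts`
(product families `𝒜 ⊗ ℬ = {a ⊔ b}` on `α ⊕ β`: `pencil_dependency_prod`, `pencil_dependency_neg`, `pencil_dependency_compl`,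
`pencil_chain_neg_one_of_chain`).  Memo: `run/shared/lean/prim/prim-ineq-gen-3/FINDINGS-gen31.md` §F31-1.

Write `LI(𝒜, t)` for 'the pencil rows `A ↦ (E ↦ [E ⊆ A] + t [E ∩ A = ∅])` (`E ∈ 𝒜 \\ 𝒜`) are linearly independent over `K`' and
`B(K) = {t : ¬ LI(𝒜, t) for some finite family 𝒜 on some type}` for the BAD LOCUS of the pencil (MS-PENCIL CONJECTURE (C0): `B(ℚ̄) = {±1}`).

* `not_linearIndependent_pencil_iff` — bridge: `¬ LI(𝒜, t)` iff there is a TOTAL coefficient function `c : Finset α → K`, non-zero on some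
  member, with `∑_{A ∈ 𝒜} c A ([E ⊆ A] + t [E ∩ A = ∅]) = 0` for all `E ∈ 𝒜 \\ 𝒜`.
* `not_linearIndependent_pencil_prod` — ★ `¬ LI(𝒜, t₁)`, `¬ LI(ℬ, t₂)` ⟹ `¬ LI(𝒜 ⊗ ℬ, −t₁t₂)`:  `B · B ⊆ −B`.
* `not_linearIndependent_pencil_inv` — `¬ LI(𝒜, t)`, `t ≠ 0` ⟹ `¬ LI(𝒜ᶜ, t⁻¹)` (`𝒜ᶜ = {S \ A}`):  `B⁻¹ = B`.
* `forall_linearIndependent_pencil_neg_iff` — ★ `(∀ families, LI(·, t)) ↔ (∀ families, LI(·, −t))` (families on types in one universe):  `−B = B`.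
  With `±1 ∈ B` (complement pairs, `…ComplementPair`) the bad locus `B(K)` is a subgroup of `Kˣ` containing `−1`.
* `forall_noChain_of_forall_noChain_neg_one` — ★★ CONJECTURE J in quantified form: if NO family (on a type of the universe) carries a left
  Jordan chain of length two at `θ = −1`, then no family carries one at any `θ ≠ 0`.
(prim-ineq-gen-3 gen 31, 2026-08-26.)
-/

namespace Summit.CriticalPhenomena.PercolationContinuityZ3.Theorems

namespace OrderedDifferences

open Finset
open scoped FinsetFamily

universe u

variable {α β : Type*} [DecidableEq α] [DecidableEq β] {K : Type*} [Field K]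

/-- **Bridge.**  The pencil rows of `𝒜` at `t` are linearly dependent iff some total coefficient function, non-zero on a member, solves the
column equations. -/
theorem not_linearIndependent_pencil_iff (𝒜 : Finset (Finset α)) (t : K) :
    (¬ LinearIndependent K (fun A : 𝒜 => fun E : (𝒜 \\ 𝒜 : Finset (Finset α)) =>
      (if (E : Finset α) ⊆ (A : Finset α) then (1 : K) else 0) +
        t * (if Disjoint (E : Finset α) (A : Finset α) then (1 : K) else 0))) ↔
    ∃ c : Finset α → K, (∃ A ∈ 𝒜, c A ≠ 0) ∧
      ∀ E ∈ 𝒜 \\ 𝒜, ∑ A ∈ 𝒜, c A * ((if E ⊆ A then (1 : K) else 0) + t * (if Disjoint E A then (1 : K) else 0)) = 0 := by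
  classical
  rw [Fintype.not_linearIndependent_iff]
  constructor
  · rintro ⟨g, hg, ⟨A₀, hA₀⟩⟩
    refine ⟨fun A => if hA : A ∈ 𝒜 then g ⟨A, hA⟩ else 0, ⟨A₀, A₀.2, by simpa using hA₀⟩, fun E hE => ?_⟩
    have h1 := congr_fun hg ⟨E, hE⟩
    simp only [Finset.sum_apply, Pi.smul_apply, smul_eq_mul, Pi.zero_apply] at h1
    rw [← sum_coe_sort 𝒜]
    simpa using h1
  · rintro ⟨c, ⟨A₀, hA₀, hc0⟩, hc⟩
    refine ⟨fun A => c A, ?_, ⟨⟨A₀, hA₀⟩, hc0⟩⟩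
    funext E
    simp only [Finset.sum_apply, Pi.smul_apply, smul_eq_mul, Pi.zero_apply]
    have h1 := hc E E.2
    rw [← sum_coe_sort 𝒜] at h1
    exact h1

/-- **`B · B ⊆ −B`.**  Dependent pencil rows at `t₁` (for `𝒜`) and at `t₂` (for `ℬ`) give dependent pencil rows at `−t₁t₂` for the product
family `𝒜 ⊗ ℬ` on `α ⊕ β`. -/
theorem not_linearIndependent_pencil_prod (𝒜 : Finset (Finset α)) (ℬ : Finset (Finset β)) {t₁ t₂ : K}
    (h₁ : ¬ LinearIndependent K (fun A : 𝒜 => fun E : (𝒜 \\ 𝒜 : Finset (Finset α)) =>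
      (if (E : Finset α) ⊆ (A : Finset α) then (1 : K) else 0) +
        t₁ * (if Disjoint (E : Finset α) (A : Finset α) then (1 : K) else 0)))
    (h₂ : ¬ LinearIndependent K (fun B : ℬ => fun E : (ℬ \\ ℬ : Finset (Finset β)) =>
      (if (E : Finset β) ⊆ (B : Finset β) then (1 : K) else 0) +
        t₂ * (if Disjoint (E : Finset β) (B : Finset β) then (1 : K) else 0))) :
    ¬ LinearIndependent K (fun P : ((𝒜 ×ˢ ℬ).image (fun p => p.1.disjSum p.2)) =>
      fun E : ((((𝒜 ×ˢ ℬ).image (fun p => p.1.disjSum p.2)) \\ ((𝒜 ×ˢ ℬ).image (fun p => p.1.disjSum p.2))) :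
        Finset (Finset (α ⊕ β))) =>
      (if (E : Finset (α ⊕ β)) ⊆ (P : Finset (α ⊕ β)) then (1 : K) else 0) +
        (-(t₁ * t₂)) * (if Disjoint (E : Finset (α ⊕ β)) (P : Finset (α ⊕ β)) then (1 : K) else 0)) := by
  rw [not_linearIndependent_pencil_iff] at h₁ h₂ ⊢
  obtain ⟨c, ⟨A₀, hA₀, hcA₀⟩, hc⟩ := h₁
  obtain ⟨d, ⟨B₀, hB₀, hdB₀⟩, hd⟩ := h₂
  refine ⟨fun P => c P.toLeft * d P.toRight, ⟨A₀.disjSum B₀, ?_, ?_⟩, pencil_dependency_prod 𝒜 ℬ c d hc hd⟩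
  · exact mem_image.mpr ⟨(A₀, B₀), mem_product.mpr ⟨hA₀, hB₀⟩, rfl⟩
  · simpa using mul_ne_zero hcA₀ hdB₀

/-- **`B⁻¹ = B`.**  Dependent pencil rows at `t ≠ 0` for `𝒜` (members inside `S`) give dependent pencil rows at `t⁻¹` for `{S \ A}`. -/
theorem not_linearIndependent_pencil_inv (𝒜 : Finset (Finset α)) (S : Finset α) (hS : ∀ A ∈ 𝒜, A ⊆ S) {t : K} (ht : t ≠ 0)
    (h : ¬ LinearIndependent K (fun A : 𝒜 => fun E : (𝒜 \\ 𝒜 : Finset (Finset α)) =>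
      (if (E : Finset α) ⊆ (A : Finset α) then (1 : K) else 0) +
        t * (if Disjoint (E : Finset α) (A : Finset α) then (1 : K) else 0))) :
    ¬ LinearIndependent K (fun C : (𝒜.image (S \ ·)) => fun E : (((𝒜.image (S \ ·)) \\ (𝒜.image (S \ ·))) : Finset (Finset α)) =>
      (if (E : Finset α) ⊆ (C : Finset α) then (1 : K) else 0) +
        t⁻¹ * (if Disjoint (E : Finset α) (C : Finset α) then (1 : K) else 0)) := by
  rw [not_linearIndependent_pencil_iff] at h ⊢
  obtain ⟨c, ⟨A₀, hA₀, hcA₀⟩, hc⟩ := h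
  refine ⟨fun C => c (S \ C), ⟨S \ A₀, mem_image.mpr ⟨A₀, hA₀, rfl⟩, ?_⟩, pencil_dependency_compl 𝒜 S hS c ht hc⟩
  show c (S \ (S \ A₀)) ≠ 0
  rwa [Finset.sdiff_sdiff_eq_self (hS A₀ hA₀)]

/-- **`−B = B`: (C0) at `t` for every family ⟺ (C0) at `−t` for every family** (families on types of a fixed universe; the product with
`{∅, {⋆}}` lives on `β ⊕ Unit`, in the same universe). -/
theorem forall_linearIndependent_pencil_neg_iff (K : Type*) [Field K] (t : K) :
    (∀ (β : Type u) [DecidableEq β] (ℬ : Finset (Finset β)),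
      LinearIndependent K (fun A : ℬ => fun E : (ℬ \\ ℬ : Finset (Finset β)) =>
        (if (E : Finset β) ⊆ (A : Finset β) then (1 : K) else 0) +
          t * (if Disjoint (E : Finset β) (A : Finset β) then (1 : K) else 0))) ↔
    (∀ (β : Type u) [DecidableEq β] (ℬ : Finset (Finset β)),
      LinearIndependent K (fun A : ℬ => fun E : (ℬ \\ ℬ : Finset (Finset β)) =>
        (if (E : Finset β) ⊆ (A : Finset β) then (1 : K) else 0) +
          (-t) * (if Disjoint (E : Finset β) (A : Finset β) then (1 : K) else 0))) := by
  constructor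
  · intro h β _ ℬ
    by_contra hn
    have h2 := not_linearIndependent_pencil_neg_of_not_linearIndependent (K := K) ℬ (t := -t) hn
    rw [neg_neg] at h2
    exact h2 (h (β ⊕ Unit) _)
  · intro h β _ ℬ
    by_contra hn
    exact not_linearIndependent_pencil_neg_of_not_linearIndependent (K := K) ℬ hn (h (β ⊕ Unit) _)

/-- **CONJECTURE J reduces to `θ = −1` (quantified form).**  If no finite family on any type (of the universe `u`) admits a left Jordan chain
of length two at `θ = −1` — no coefficient functions `c₀, c₁` with `c₀` non-zero on a member, `c₀ (Z − Y) = 0` and `c₁ (Z − Y) + c₀ Y = 0`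
on the difference set — then no family admits one at any `θ ≠ 0`. -/
theorem forall_noChain_of_forall_noChain_neg_one (K : Type*) [Field K]
    (h : ∀ (β : Type u) [DecidableEq β] (ℬ : Finset (Finset β)) (c₀ c₁ : Finset β → K),
      (∀ E ∈ ℬ \\ ℬ, ∑ A ∈ ℬ, c₀ A * ((if E ⊆ A then (1 : K) else 0) + (-1) * (if Disjoint E A then (1 : K) else 0)) = 0) →
      (∀ E ∈ ℬ \\ ℬ, ∑ A ∈ ℬ, (c₁ A * ((if E ⊆ A then (1 : K) else 0) + (-1) * (if Disjoint E A then (1 : K) else 0)) +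
        c₀ A * (if Disjoint E A then (1 : K) else 0)) = 0) →
      ∀ A ∈ ℬ, c₀ A = 0)
    (β : Type u) [DecidableEq β] (ℬ : Finset (Finset β)) {θ : K} (hθ : θ ≠ 0) (c₀ c₁ : Finset β → K)
    (hc₀ : ∀ E ∈ ℬ \\ ℬ, ∑ A ∈ ℬ, c₀ A * ((if E ⊆ A then (1 : K) else 0) + θ * (if Disjoint E A then (1 : K) else 0)) = 0)
    (hc₁ : ∀ E ∈ ℬ \\ ℬ, ∑ A ∈ ℬ, (c₁ A * ((if E ⊆ A then (1 : K) else 0) + θ * (if Disjoint E A then (1 : K) else 0)) +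
      c₀ A * (if Disjoint E A then (1 : K) else 0)) = 0) :
    ∀ A ∈ ℬ, c₀ A = 0 := by
  classical
  -- all members lie in `S := ⋃ ℬ`
  set S : Finset β := ℬ.sup id with hS
  have hSub : ∀ A ∈ ℬ, A ⊆ S := fun A hA => Finset.le_sup (f := id) hA
  obtain ⟨h0, h1⟩ := pencil_chain_neg_one_of_chain ℬ S hSub c₀ c₁ hθ hc₀ hc₁
  have key := h (β ⊕ β) ((ℬ ×ˢ ℬ.image (S \ ·)).image (fun p => p.1.disjSum p.2))
    (fun P => c₀ P.toLeft * c₀ (S \ P.toRight)) (fun P => -θ * (c₁ P.toLeft * c₀ (S \ P.toRight))) h0 h1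
  -- if `c₀ A ≠ 0` then the product coefficient at `A ⊔ (S \ A)` is `c₀ A * c₀ A ≠ 0`
  intro A hA
  by_contra hne
  have hmem : A.disjSum (S \ A) ∈ (ℬ ×ˢ ℬ.image (S \ ·)).image (fun p => p.1.disjSum p.2) :=
    mem_image.mpr ⟨(A, S \ A), mem_product.mpr ⟨hA, mem_image.mpr ⟨A, hA, rfl⟩⟩, rfl⟩
  have h2 := key _ hmem
  simp only [toLeft_disjSum, toRight_disjSum, Finset.sdiff_sdiff_eq_self (hSub A hA)] at h2
  exact mul_ne_zero hne hne h2

end OrderedDifferences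

end Summit.CriticalPhenomena.PercolationContinuityZ3.Theorems
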